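import Summits.QuantumFields.BalabanUV.T4Continuum.Support.NE7GaugeStepLetters
import Summits.QuantumFields.BalabanUV.T4Continuum.Support.NE7CornerGaugeRegauge
import Summits.QuantumFields.BalabanUV.T4Continuum.Support.NE7GradientCurrency
import Summits.QuantumFields.BalabanUV.T4Continuum.Support.NE3SmoothLiftCurl
import Summits.QuantumFields.BalabanUV.T4Continuum.Support.AveragingDeficitNearIdentity
import Summits.QuantumFields.BalabanUV.T4Continuum.Support.NE3EnergyShapes
import HarnessLib

/-!
# NE7SliceStepLetters — THE LATTICE LETTERS OF ONE NONLINEAR STEP OF THE REP♭ SUP INDUCTION: the flat curl of the logarithm of a small field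
# (`≤ ε + 32s²`), the skew part of a gauge function, the links after the gauge step `e^{τ}` (`≤ 2ρ + 8(t + ρ + s)(ρ + s)`), the corner letter on the
# lattice (`‖G(Λ(z+e_ι)) − G(Λz)‖ ≤ Λρ₁ + η`) and the PINNING by p2's corner-gauge interpolation (154e) (`NE7SliceStepLetters`)

Cell `pub-balaban`, lineage `t4-ne7-p1` (CRUX PROVER NE7 #1 = OWNER of row NE7), gen 73; the T4-carrier letters feeding the step file
`NE7SliceStepNonlinear` of the road `t4/b2b-balaban-t4-ne7-p1-g73/REP-FLAT-ROAD-v2.md` §2 (s5)–(s6).  Composition BY NAME over `NE7GaugeStepLetters`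
(the `e^{T}e^{A}e^{−T′}` letter without `‖T‖²` term; the corner letter), `NE7GradientCurrency.hol_vary_flat_plaqWord` ∕ `norm_plaqRem_sub_plaqRem_le`
(plaquette of `e^{A}` vs. its linear part), `AveragingDeficitNearIdentity.norm_hol_sub_one_le_of_bonds` (straight transporters of a field with small
links), `NE7CornerGaugeRegauge.norm_link_sub_one_le` and (154e) `NE7CornerGaugeInterpolation.exists_smooth_corner_gauge` (unitary interpolant `w` of
corner data with `‖∇w‖ ≤ 8ω∕Λ`).

CONTENT ([folklore]; 0 def, 0 sorry): §1 `skewHalf_mem`, `norm_sub_skewHalf_le`, `norm_skewHalf_le`, **`norm_curlAt_flat_le_of_plaq`**; §2 `two_mul_lt_log_two`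
(numeric), **`norm_gaugeStep_links_le`**, **`norm_corner_sub_corner_le`**, **`exists_pinned_gauge`** (`g′ := w⁻¹·G` is pinned at the level corners
`Λz`, periodic, links `≤ ρ₁ + 8ω∕Λ`).

HONEST FRAMING (page 1): elementary bookkeeping on OUR T4 carriers; nothing of Bałaban's is used or claimed; REP♭ NOT proved here; (APE) NOT proved;
NE7 NOT PRINTED ∕ NOT PROVED; spine PROVED 0∕9; finite T⁴ rung (B)+1 — NOT infinite volume, NOT mass gap, NOT BetaPertH, NOT Clay.  PLACEMENT: our
lemma, under `Summits/QuantumFields/BalabanUV/`.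
Continuum YM on T⁴ ⇐ BetaPertH ∧ nine spine estimates (0/9 proved); BetaPertH ⇐ (D1) ∧ (D4) ∧ CAP+tail; G-an2-4 gates asym, D1 and NE2/3/4.
-/

set_option autoImplicit false

open scoped BigOperators Matrix Matrix.Norms.L2Operator
open NormedSpace Finset

namespace Summit.QuantumFields.BalabanUV.T4Continuum.NE7SliceStepLetters

open Literature.MathematicalPhysics.QuantumFieldTheory.Balaban1983to89
open B7Prop1Explicit B7Prop2Explicit MatrixLog
open T4AveragingDeficitWall (IsUnitaryCfg IsSkewDir SmallField vary curlAt)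
open AveragingDeficitNearIdentity (norm_hol_sub_one_le_of_bonds)
open BlockAveragePushDirSplit (flat)
open NE3EnergyShapes (IsUnitarySite IsPeriodicSite)
open NE3SmoothLiftCurl (curlAt_flat_eq)
open NE7GradientCurrency (hol_vary_flat_plaqWord norm_plaqRem_sub_plaqRem_le)
open NE7GaugeStepLetters (norm_gaugeStep_link_sub_one_le norm_sub_le_of_transporter_units)
open NE7CornerGaugeInterpolation (exists_smooth_corner_gauge)
open NE7CornerGaugeRegauge (norm_link_sub_one_le)
open NE7GeodesicSecondOrder (norm_inv_sub_inv)

noncomputable section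

variable {d : ℕ} {n : Type*} [Fintype n] [DecidableEq n]

/-! ## §1 Small letters -/

omit [Fintype n] [DecidableEq n] in
/-- the skew part `½(X − Xᴴ)` is skew. [folklore] -/
theorem skewHalf_mem (X : Matrix n n ℂ) : (1 / 2 : ℝ) • (X - star X) ∈ skewAdjoint (Matrix n n ℂ) := by
  rw [skewAdjoint.mem_iff, star_smul, star_sub, star_star, star_trivial, ← smul_neg, neg_sub]

/-- the skew part is a contraction towards skew matrices: `‖A − ½(X − Xᴴ)‖ ≤ ‖A − X‖` for skew `A`. [folklore] -/
theorem norm_sub_skewHalf_le {A : Matrix n n ℂ} (hA : A ∈ skewAdjoint (Matrix n n ℂ)) (X : Matrix n n ℂ) :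
    ‖A - (1 / 2 : ℝ) • (X - star X)‖ ≤ ‖A - X‖ := by
  have hA' : star A = -A := skewAdjoint.mem_iff.mp hA
  have hid : A - (1 / 2 : ℝ) • (X - star X) = (1 / 2 : ℝ) • ((A - X) - star (A - X)) := by
    rw [star_sub, hA', smul_sub, smul_sub]
    module
  rw [hid, norm_smul, Real.norm_of_nonneg (by norm_num : (0 : ℝ) ≤ 1 / 2)]
  calc 1 / 2 * ‖(A - X) - star (A - X)‖ ≤ 1 / 2 * (‖A - X‖ + ‖star (A - X)‖) := by gcongr; exact norm_sub_le _ _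
    _ = ‖A - X‖ := by rw [norm_star]; ring

/-- `‖½(X − Xᴴ)‖ ≤ ‖X‖`. [folklore] -/
theorem norm_skewHalf_le (X : Matrix n n ℂ) : ‖(1 / 2 : ℝ) • (X - star X)‖ ≤ ‖X‖ := by
  have h := norm_sub_skewHalf_le (A := 0) (skewAdjoint (Matrix n n ℂ)).zero_mem X
  rwa [zero_sub, zero_sub, norm_neg, norm_neg] at h

/-- the flat curl of the logarithm of a small field: for `A` with `‖A‖ ≤ s ≤ 1∕64` and `‖e^{A}e^{A}e^{−A}e^{−A}(plaquette) − 1‖ ≤ ε`,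
`‖curlAt 1 A‖ ≤ ε + 32s²`. [folklore] -/
theorem norm_curlAt_flat_le_of_plaq [Nonempty n] (A : Site (d + 1) → Fin (d + 1) → Matrix n n ℂ) {s ε : ℝ} (hs : 0 ≤ s) (hs64 : s ≤ 1 / 64)
    (hA : ∀ (y : Site (d + 1)) (κ : Fin (d + 1)), ‖A y κ‖ ≤ s) (hε : 0 ≤ ε)
    (hplaq : ∀ (x : Site (d + 1)) (μ ν : Fin (d + 1)), μ ≠ ν →
      ‖((hol (vary (flat (d := d + 1) (n := n)) A 1) x (plaqWord μ ν) : (Matrix n n ℂ)ˣ) : Matrix n n ℂ) - 1‖ ≤ ε)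
    (x : Site (d + 1)) (μ ν : Fin (d + 1)) : ‖curlAt (flat (d := d + 1) (n := n)) A x μ ν‖ ≤ ε + 32 * s ^ 2 := by
  by_cases hμν : μ = ν
  · subst hμν
    rw [curlAt_flat_eq, sub_self, norm_zero]; positivity
  have hP := hplaq x μ ν hμν
  rw [hol_vary_flat_plaqWord] at hP
  have hsum : A x μ + A (x + e μ) ν + -A (x + e ν) μ + -A x ν = curlAt (flat (d := d + 1) (n := n)) A x μ ν := by
    rw [curlAt_flat_eq]; abel
  have hrem := norm_plaqRem_sub_plaqRem_le (𝔸 := Matrix n n ℂ) (hA x μ) (hA (x + e μ) ν) (by rw [norm_neg]; exact hA (x + e ν) μ)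
    (by rw [norm_neg]; exact hA x ν) (y₁ := 0) (y₂ := 0) (y₃ := 0) (y₄ := 0)
    (by rw [norm_zero]; exact hs) (by rw [norm_zero]; exact hs) (by rw [norm_zero]; exact hs) (by rw [norm_zero]; exact hs)
  simp only [exp_zero, mul_one, sub_self, add_zero, sub_zero, hsum] at hrem
  have h4 : Real.exp (4 * s) - 1 ≤ 8 * s := exp4_sub_one_le hs hs64
  have hxs : ‖A x μ‖ + ‖A (x + e μ) ν‖ + ‖A (x + e ν) μ‖ + ‖A x ν‖ ≤ 4 * s := by
    linarith [hA x μ, hA (x + e μ) ν, hA (x + e ν) μ, hA x ν]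
  set P4 := exp (A x μ) * exp (A (x + e μ) ν) * exp (-A (x + e ν) μ) * exp (-A x ν) with hP4
  have hrem' : ‖P4 - 1 - curlAt (flat (d := d + 1) (n := n)) A x μ ν‖ ≤ 32 * s ^ 2 := by
    refine hrem.trans ?_
    rw [norm_neg, norm_neg]
    have he0 : 0 ≤ Real.exp (4 * s) - 1 := by have := Real.one_le_exp (show 0 ≤ 4 * s by positivity); linarith
    calc (Real.exp (4 * s) - 1) * (‖A x μ‖ + ‖A (x + e μ) ν‖ + ‖A (x + e ν) μ‖ + ‖A x ν‖)
        ≤ (8 * s) * (4 * s) := mul_le_mul h4 hxs (by positivity) (by positivity)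
      _ = 32 * s ^ 2 := by ring
  calc ‖curlAt (flat (d := d + 1) (n := n)) A x μ ν‖ = ‖(P4 - 1) - (P4 - 1 - curlAt (flat (d := d + 1) (n := n)) A x μ ν)‖ := by
        rw [sub_sub_cancel]
    _ ≤ ‖P4 - 1‖ + ‖P4 - 1 - curlAt (flat (d := d + 1) (n := n)) A x μ ν‖ := norm_sub_le _ _
    _ ≤ ε + 32 * s ^ 2 := add_le_add hP hrem'

/-! ## §2 The gauge step, the corner letter, the pinning -/

/-- numeric: the σ-line `4(3+12D)²·Λs ≤ rho0²` (`rho0 ≤ 1`, `D ≥ 1`) puts `2(3+12D)·Λs` below `log 2`. [folklore] -/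
theorem two_mul_lt_log_two {D Λs r : ℝ} (hD : 1 ≤ D) (hr0 : 0 ≤ r) (hr1 : r ≤ 1)
    (h : 4 * (3 + 12 * D) ^ 2 * Λs ≤ r ^ 2) : 2 * (3 + 12 * D) * Λs < Real.log 2 := by
  have hK : (15 : ℝ) ≤ 3 + 12 * D := by linarith
  have hr2 : r ^ 2 ≤ 1 := by nlinarith
  have h1 : 4 * (3 + 12 * D) ^ 2 * Λs ≤ 1 := h.trans hr2
  have h2 : 2 * (3 + 12 * D) * Λs ≤ 1 / 30 := by
    rw [le_div_iff₀ (by norm_num : (0 : ℝ) < 30)]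
    nlinarith
  have hlog : (1 : ℝ) / 30 < Real.log 2 := by have := Real.log_two_gt_d9; linarith
  linarith

/-- **THE GAUGE STEP `e^{τ}`** (§5 of the step): for links `e^{A}` (unitary) with `‖A‖ ≤ s`, a skew gauge function `τ` with `‖τ‖ ≤ t ≤ 1∕4` and
`‖A − ∇τ‖ ≤ ρ`, `ρ + s ≤ 1∕4`: the links of the re-gauged field are `(2ρ + 8(t + (ρ + s))(ρ + s))`-close to `1` (`NE7GaugeStepLetters`). [folklore] -/
theorem norm_gaugeStep_links_le [Nonempty n] {W : Site (d + 1) → Fin (d + 1) → (Matrix n n ℂ)ˣ}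
    {A : Site (d + 1) → Fin (d + 1) → Matrix n n ℂ} (hWA : ∀ (y : Site (d + 1)) (κ : Fin (d + 1)), ((W y κ : (Matrix n n ℂ)ˣ) : Matrix n n ℂ) = exp (A y κ))
    {τ : Site (d + 1) → Matrix n n ℂ} (hτs : ∀ y, τ y ∈ skewAdjoint (Matrix n n ℂ)) {s t ρ : ℝ}
    (hAn : ∀ (y : Site (d + 1)) (κ : Fin (d + 1)), ‖A y κ‖ ≤ s) (hτn : ∀ y, ‖τ y‖ ≤ t)
    (hτA : ∀ (y : Site (d + 1)) (κ : Fin (d + 1)), ‖A y κ - (τ (y + e κ) - τ y)‖ ≤ ρ) (ht4 : t ≤ 1 / 4) (hρs : ρ + s ≤ 1 / 4)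
    (y : Site (d + 1)) (κ : Fin (d + 1)) :
    ‖((gaugeAct (fun y => expUnit (τ y)) W y κ : (Matrix n n ℂ)ˣ) : Matrix n n ℂ) - 1‖ ≤ 2 * ρ + 8 * (t + (ρ + s)) * (ρ + s) := by
  letI : CStarAlgebra (Matrix n n ℂ) := {}
  have hs0 : 0 ≤ s := (norm_nonneg _).trans (hAn y κ)
  have hρ0 : 0 ≤ ρ := (norm_nonneg _).trans (hτA y κ)
  have hval : ((gaugeAct (fun y => expUnit (τ y)) W y κ : (Matrix n n ℂ)ˣ) : Matrix n n ℂ) = exp (τ y) * exp (A y κ) * exp (-τ (y + e κ)) := by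
    simp only [gaugeAct, Units.val_mul, val_inv_expUnit, val_expUnit, hWA]
  rw [hval]
  have hD : ‖τ (y + e κ) - τ y‖ ≤ ρ + s := by
    calc ‖τ (y + e κ) - τ y‖ = ‖A y κ - (A y κ - (τ (y + e κ) - τ y))‖ := by rw [sub_sub_cancel]
      _ ≤ ‖A y κ‖ + ‖A y κ - (τ (y + e κ) - τ y)‖ := norm_sub_le _ _
      _ ≤ s + ρ := add_le_add (hAn y κ) (hτA y κ)
      _ = ρ + s := add_comm _ _
  have h := norm_gaugeStep_link_sub_one_le (hτs y) (hτs (y + e κ)) ((hAn y κ).trans (by linarith)) ((hτn y).trans ht4)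
    (hD.trans hρs)
  refine h.trans ?_
  have h1 : 2 * ‖A y κ - (τ (y + e κ) - τ y)‖ ≤ 2 * ρ := by linarith [hτA y κ]
  have h2 : 8 * (‖τ y‖ + ‖τ (y + e κ) - τ y‖) * ‖τ (y + e κ) - τ y‖ ≤ 8 * (t + (ρ + s)) * (ρ + s) := by
    have hx : ‖τ y‖ + ‖τ (y + e κ) - τ y‖ ≤ t + (ρ + s) := add_le_add (hτn y) hD
    have h0 := norm_nonneg (τ (y + e κ) - τ y)
    have h0' := norm_nonneg (τ y)
    exact mul_le_mul (mul_le_mul_of_nonneg_left hx (by norm_num)) hD h0 (by linarith [hτn y])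
  linarith

/-- **THE CORNER LETTER ON THE LATTICE** (§6 of the step): if all links of `V^G` are `ρ₁`-close to `1` and the straight transporter of `V` from the corner
`Λz` over `Λ` steps in direction `ι` is `η`-close to `1`, then `‖G(Λ(z+e_ι)) − G(Λz)‖ ≤ Λρ₁ + η`. [folklore] -/
theorem norm_corner_sub_corner_le [Nonempty n] {V : Site (d + 1) → Fin (d + 1) → (Matrix n n ℂ)ˣ} (hVu : IsUnitaryCfg V)
    {G : Site (d + 1) → (Matrix n n ℂ)ˣ} (hGu : IsUnitarySite G) {Λ : ℕ} {ρ₁ η : ℝ}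
    (hlinks : ∀ (y : Site (d + 1)) (κ : Fin (d + 1)), ‖((gaugeAct G V y κ : (Matrix n n ℂ)ˣ) : Matrix n n ℂ) - 1‖ ≤ ρ₁)
    (z : Site (d + 1)) (ι : Fin (d + 1))
    (hη : ‖((hol V (((Λ : ℕ) : ℤ) • z) (seg ι ((Λ : ℕ) : ℤ)) : (Matrix n n ℂ)ˣ) : Matrix n n ℂ) - 1‖ ≤ η) :
    ‖(G (((Λ : ℕ) : ℤ) • (z + e ι)) : Matrix n n ℂ) - G (((Λ : ℕ) : ℤ) • z)‖ ≤ (Λ : ℝ) * ρ₁ + η := by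
  letI : CStarAlgebra (Matrix n n ℂ) := {}
  have hGVu : IsUnitaryCfg (gaugeAct G V) := by
    intro y κ
    simp only [gaugeAct]
    exact (unitaryUnits _).mul_mem ((unitaryUnits _).mul_mem (hGu _) (hVu _ _)) ((unitaryUnits _).inv_mem (hGu _))
  have hholG : hol (gaugeAct G V) (((Λ : ℕ) : ℤ) • z) (seg ι ((Λ : ℕ) : ℤ))
      = G (((Λ : ℕ) : ℤ) • z) * hol V (((Λ : ℕ) : ℤ) • z) (seg ι ((Λ : ℕ) : ℤ)) * (G (((Λ : ℕ) : ℤ) • (z + e ι)))⁻¹ := by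
    rw [hol_gaugeAct, disp_seg, ← smul_add]
  have hseg : ‖((hol (gaugeAct G V) (((Λ : ℕ) : ℤ) • z) (seg ι ((Λ : ℕ) : ℤ)) : (Matrix n n ℂ)ˣ) : Matrix n n ℂ) - 1‖ ≤ (Λ : ℝ) * ρ₁ := by
    have h := norm_hol_sub_one_le_of_bonds hGVu (β := ρ₁) (((Λ : ℕ) : ℤ) • z) (seg ι ((Λ : ℕ) : ℤ)) (fun b _ => hlinks b.1 b.2)
    rwa [length_seg, Int.natAbs_natCast] at h
  have h := norm_sub_le_of_transporter_units (h := hol V (((Λ : ℕ) : ℤ) • z) (seg ι ((Λ : ℕ) : ℤ))) (hGu (((Λ : ℕ) : ℤ) • z))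
    (hGu (((Λ : ℕ) : ℤ) • (z + e ι)))
  rw [← hholG] at h
  rw [norm_sub_rev]
  exact h.trans (add_le_add hseg hη)

/-- **THE PINNING** (§7 of the step, p2's (154e)): a unitary `(ΛN′)`-periodic gauge `G` whose links are `ρ₁`-close to `1` and whose values at
neighbouring level corners `Λz` oscillate by `≤ ω`, `300(d+1)ω ≤ 1`, is corrected by the corner-gauge interpolant `w` of its corner values to
`g′ := w⁻¹·G`, PINNED (`g′(Λz) = 1`), periodic, with links `(ρ₁ + 8ω∕Λ)`-close to `1`. [folklore] -/
theorem exists_pinned_gauge [Nonempty n] {V : Site (d + 1) → Fin (d + 1) → (Matrix n n ℂ)ˣ}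
    {G : Site (d + 1) → (Matrix n n ℂ)ˣ} (hGu : IsUnitarySite G) {Λ N' : ℕ} (hΛ : 1 ≤ Λ) (hGP : IsPeriodicSite G ((Λ * N' : ℕ) : ℤ))
    {ρ₁ ω : ℝ} (hlinks : ∀ (y : Site (d + 1)) (κ : Fin (d + 1)), ‖((gaugeAct G V y κ : (Matrix n n ℂ)ˣ) : Matrix n n ℂ) - 1‖ ≤ ρ₁)
    (hω : ∀ (z : Site (d + 1)) (ι : Fin (d + 1)), ‖(G (((Λ : ℕ) : ℤ) • (z + e ι)) : Matrix n n ℂ) - G (((Λ : ℕ) : ℤ) • z)‖ ≤ ω)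
    (hωd : 300 * ((d + 1 : ℕ) : ℝ) * ω ≤ 1) :
    ∃ g' : Site (d + 1) → (Matrix n n ℂ)ˣ, IsUnitarySite g' ∧ IsPeriodicSite g' ((Λ * N' : ℕ) : ℤ) ∧
      (∀ z : Site (d + 1), g' (((Λ : ℕ) : ℤ) • z) = 1) ∧
      (∀ (y : Site (d + 1)) (κ : Fin (d + 1)), ‖((gaugeAct g' V y κ : (Matrix n n ℂ)ˣ) : Matrix n n ℂ) - 1‖ ≤ ρ₁ + 8 * ω / Λ) := by
  letI : CStarAlgebra (Matrix n n ℂ) := {}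
  have hvU : ∀ z : Site (d + 1), G (((Λ : ℕ) : ℤ) • z) ∈ unitaryUnits (Matrix n n ℂ) := fun z => hGu _
  have hvP : ∀ (z : Site (d + 1)) (ι : Fin (d + 1)), G (((Λ : ℕ) : ℤ) • (z + (N' : ℤ) • e ι)) = G (((Λ : ℕ) : ℤ) • z) := by
    intro z ι
    rw [smul_add, smul_smul, show ((Λ : ℕ) : ℤ) * (N' : ℤ) = ((Λ * N' : ℕ) : ℤ) by push_cast; ring, hGP]
  have hvω : ∀ (z : Site (d + 1)) (ι : Fin (d + 1)), ‖(G (((Λ : ℕ) : ℤ) • (z + e ι)) : Matrix n n ℂ) - G (((Λ : ℕ) : ℤ) • z)‖ ≤ ω := hω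
  obtain ⟨w, hwU, hwP, hwc, hw1, -⟩ :=
    exists_smooth_corner_gauge (𝔸 := Matrix n n ℂ) (v := fun z => G (((Λ : ℕ) : ℤ) • z)) hΛ N' hvU hvP hvω hωd
  refine ⟨fun y => (w y)⁻¹ * G y, fun y => (unitaryUnits _).mul_mem ((unitaryUnits _).inv_mem (hwU y)) (hGu y),
    fun y ι => by simp only [hwP, hGP y ι], fun z => ?_, fun y κ => ?_⟩
  · show (w (((Λ : ℕ) : ℤ) • z))⁻¹ * G (((Λ : ℕ) : ℤ) • z) = 1
    rw [hwc z, inv_mul_cancel]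
  · have hfac : gaugeAct (fun y => (w y)⁻¹ * G y) V y κ = (w y)⁻¹ * gaugeAct G V y κ * ((w (y + e κ))⁻¹)⁻¹ := by
      simp only [gaugeAct, mul_inv_rev, inv_inv, mul_assoc]
    rw [hfac, Units.val_mul, Units.val_mul]
    refine (norm_link_sub_one_le ((unitaryUnits _).inv_mem (hwU y)) ((unitaryUnits _).inv_mem (hwU (y + e κ))) _).trans ?_
    rw [norm_inv_sub_inv (hwU y) (hwU (y + e κ)), norm_sub_rev ((w y : (Matrix n n ℂ)ˣ) : Matrix n n ℂ) (w (y + e κ))]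
    exact add_le_add (hlinks y κ) (hw1 y κ)


end

end Summit.QuantumFields.BalabanUV.T4Continuum.NE7SliceStepLetters
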